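import Literature.GroupTheory.FreeNormalSubgroupCompletionCentralizer
import Literature.GroupTheory.SlimNormalExtension
import Literature.AnabelianGeometry.AbsoluteAnabelian.ProfiniteSlimAscentSharp
import HarnessLib

/-!
# `C_{M̂}(η Λ) = 1` for a normal subgroup `Λ` of finite index — ABSTRACT form (centraliser condition,
# centre-free torsion-free `Λ̂`, one primitive element)

Topic `Literature/GroupTheory` (abc-iut cell, campaign-L residual «J2»; [AbsTopIII] Lemma 4.3
"`Π_{[X/Aut X]}` is slim" as used in the proof of Prop. 4.2 (i), kurims p. 106).  PROOF-ONLY file (no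
definition, no named fact).  The tree's `eq_one_of_forall_commute_toCompletion`
(`FreeNormalSubgroupCompletionCentralizer.lean`) proves, for `Λ ⊴ M` FREE of finite index with
`C_M(Λ) = 1`, that every element of `M̂` commuting with `η(Λ)` is trivial.  Its proof uses freeness
only through five properties, which this file takes as HYPOTHESES, so that the same statement becomes
available for every class of groups for which the tree supplies them (free groups: the original file;
orientable SURFACE groups: the companion `SurfaceNormalSubgroupCompletionCentralizer.lean`):

* (CC) the CENTRALISER CONDITION for `Λ ≤ M`: an element of `M̂` commuting with `η(x)`, `x ∈ Λ`,
  lies in the closure of `η(C_M(x))` (tree: `centralizer_toCompletion_eq_closure_of_isFreeGroup'`,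
  `mem_closure_centralizer_of_commute_of_hcs` — hereditary conjugacy separability);
* (Z)  the profinite completion `Λ̂` of the abstract group `Λ` is centre-free;
* (T)  `Λ̂` is torsion-free;
* (RF) `η_Λ : Λ → Λ̂` is injective (`Λ` residually finite);
* (P)  `Λ` has an element `x` with `C_Λ(x) = ⟨x⟩` admitting a homomorphism `Λ → ℤ` with `x ↦ 1`.

Results:
* `eq_one_of_forall_commute_toCompletion_of_hyps` — under (CC), (Z), (T), (RF), (P) and `C_M(Λ) = 1`:
  `∀ y ∈ M̂, (∀ λ ∈ Λ, y η(λ) = η(λ) y) → y = 1` (argument: module docstring of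
  `FreeNormalSubgroupCompletionCentralizer.lean`, verbatim with the five inputs abstracted);
* `isSlimGroup_completion_of_slim_of_centralizer_trivial` — if moreover `Λ̂` is SLIM then `M̂` is slim
  (closure of `η(Λ)` is a normal subgroup isomorphic to `Λ̂`; extension step
  `IsSlimGroup.of_normal_of_centralizer_eq_bot`);
* `centralizer_eq_zpowers_of_isCyclic_of_map_eq` — (P) from "centralisers are cyclic" and a character.

Classical group theory; OUR kernel check; nothing here bears on [IUTchIII] Cor. 3.12 or takes a side.
-/

noncomputable section

namespace Literature.GroupTheory

open Literature.AlgebraicGeometry.Frobenioids (IsSlimGroup)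
open Literature.IUT.HodgeTheaters (profiniteCompletion toCompletion)
open Literature.IUT.HodgeTheaters.ProfiniteCompletion
open CategoryTheory ProfiniteGrp ProfiniteGrp.ProfiniteCompletion
open _root_.Topology

universe u

variable {M : Type u} [Group M]

/-! ### (P) from cyclic centralisers -/

/-- If the centraliser of `x` is cyclic and `x` maps to a generator of `ℤ` under some homomorphism,
then `C(x) = ⟨x⟩` (a generator `c` of `C(x)` has `x = c ^ n` with `n · φ(c) = 1`, so `n = ±1`).
[cite: Mochizuki2012, Lem 2.7(iv) p.57] -/
theorem centralizer_eq_zpowers_of_isCyclic_of_map_eq {L : Type u} [Group L] {x : L}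
    (hcyc : IsCyclic (Subgroup.centralizer ({x} : Set L))) (φ : L →* Multiplicative ℤ)
    (hφ : φ x = Multiplicative.ofAdd 1) :
    Subgroup.centralizer ({x} : Set L) = Subgroup.zpowers x := by
  have hxC : x ∈ Subgroup.centralizer ({x} : Set L) := by
    rw [Subgroup.mem_centralizer_iff]
    intro y hy
    rw [Set.mem_singleton_iff] at hy
    rw [hy]
  obtain ⟨⟨c, hc⟩, hgen⟩ := hcyc.exists_generator
  refine le_antisymm ?_ ?_
  · intro w hw
    obtain ⟨i, hi⟩ := hgen ⟨w, hw⟩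
    obtain ⟨n, hn⟩ := hgen ⟨x, hxC⟩
    have hi' : c ^ i = w := by simpa using congrArg Subtype.val hi
    have hn' : c ^ n = x := by simpa using congrArg Subtype.val hn
    -- `n = ±1`
    have hn1 : n = 1 ∨ n = -1 :=
      not_isPower_of_map_eq_ofAdd_one φ hφ c n hn'
    rw [Subgroup.mem_zpowers_iff]
    rcases hn1 with rfl | rfl
    · exact ⟨i, by rw [← hn', zpow_one, hi']⟩
    · refine ⟨-i, ?_⟩
      rw [← hn', ← hi', ← zpow_mul]
      congr 1
      ring
  · rw [Subgroup.zpowers_le]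
    exact hxC

/-! ### The abstract main theorem -/

section Abstract

variable (Λ : Subgroup M) [Λ.FiniteIndex]

/-- (Z) ⇒ an element of the closure of `η(Λ)` commuting with `η(Λ)` is trivial (it corresponds under
the comparison `Λ̂ ≅ closure η(Λ)` to a central element of `Λ̂`). [cite: RibesZalesskii2010, §3.2] -/
theorem eq_one_of_mem_closure_of_forall_commute_of_center_trivial
    (hZ : ∀ z : profiniteCompletion Λ, (∀ w, w * z = z * w) → z = 1) {k : profiniteCompletion M}
    (hk : k ∈ closure (toCompletion M '' (Λ : Set M)))
    (hcomm : ∀ l ∈ Λ, k * toCompletion M l = toCompletion M l * k) : k = 1 := by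
  obtain ⟨ι, -, hιi, hιη, hιr⟩ := exists_comparison Λ
  obtain ⟨z, rfl⟩ : k ∈ Set.range ι := by rw [hιr]; exact hk
  suffices hz : z = 1 by rw [hz, map_one]
  have h1 : ∀ l : Λ, z * toCompletion Λ l = toCompletion Λ l * z := fun l =>
    hιi (by rw [map_mul, map_mul, hιη]; exact hcomm l l.2)
  exact hZ z fun w => (denseRange (GrpCat.of Λ)).induction_on w
    (isClosed_eq (continuous_id.mul continuous_const) (continuous_const.mul continuous_id))
    (fun l => (h1 l).symm)

/-- (T) ⇒ an element of finite order of the closure of `η(Λ)` is trivial. [cite: RibesZalesskii2010, §3.2] -/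
theorem eq_one_of_mem_closure_of_pow_eq_one_of_torsionFree
    (hT : ∀ (z : profiniteCompletion Λ) (n : ℕ), 0 < n → z ^ n = 1 → z = 1)
    {k : profiniteCompletion M} (hk : k ∈ closure (toCompletion M '' (Λ : Set M)))
    {n : ℕ} (hn : 0 < n) (h : k ^ n = 1) : k = 1 := by
  obtain ⟨ι, -, hιi, -, hιr⟩ := exists_comparison Λ
  obtain ⟨z, rfl⟩ : k ∈ Set.range ι := by rw [hιr]; exact hk
  have hz : z ^ n = 1 := hιi (by rw [map_pow, h, map_one])
  rw [hT z n hn hz, map_one]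

/-- (RF) ⇒ `η_M` is injective on `Λ`. [cite: RibesZalesskii2010, §3.2] -/
theorem eq_one_of_toCompletion_eq_one_of_injective (hη : Function.Injective (toCompletion Λ))
    {l : M} (hl : l ∈ Λ) (h : toCompletion M l = 1) : l = 1 := by
  obtain ⟨ι, -, hιi, hιη, -⟩ := exists_comparison Λ
  have h1 : toCompletion Λ ⟨l, hl⟩ = 1 := hιi (by rw [hιη, map_one]; exact h)
  have h3 : (⟨l, hl⟩ : Λ) = 1 := hη (h1.trans (map_one (toCompletion Λ)).symm)
  exact congrArg Subtype.val h3

variable [Λ.Normal]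

/-- **Abstract main theorem: `C_{M̂}(η Λ) = 1`.**  Let `Λ ⊴ M` be normal of finite index with
`C_M(Λ) = 1`, and assume (CC) the centraliser condition for the elements of `Λ` in `M̂`, (Z) `Λ̂`
centre-free, (T) `Λ̂` torsion-free, (RF) `η_Λ` injective, (P) an element `x ∈ Λ` with `C_Λ(x) = ⟨x⟩`
and a character `Λ → ℤ` taking `x` to `1`.  Then every `y ∈ M̂` commuting with `η(Λ)` is trivial.
(Free `Λ`: `eq_one_of_forall_commute_toCompletion`; surface `Λ`: companion file.)
[cite: MochizukiAbsTopIII2015, Proposition 4.2 (i) proof p.106] -/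
theorem eq_one_of_forall_commute_toCompletion_of_hyps
    (hCC : ∀ x ∈ Λ, ∀ σ : profiniteCompletion M, σ * toCompletion M x = toCompletion M x * σ →
      σ ∈ closure (toCompletion M '' (Subgroup.centralizer ({x} : Set M) : Set M)))
    (hZ : ∀ z : profiniteCompletion Λ, (∀ w, w * z = z * w) → z = 1)
    (hT : ∀ (z : profiniteCompletion Λ) (n : ℕ), 0 < n → z ^ n = 1 → z = 1)
    (hη : Function.Injective (toCompletion Λ))
    (hx : ∃ x : Λ, Subgroup.centralizer ({x} : Set Λ) = Subgroup.zpowers x ∧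
      ∃ φ : Λ →* Multiplicative ℤ, φ x = Multiplicative.ofAdd 1)
    (hC : Subgroup.centralizer (Λ : Set M) = ⊥)
    (y : profiniteCompletion M)
    (hy : ∀ l ∈ Λ, y * toCompletion M l = toCompletion M l * y) : y = 1 := by
  classical
  -- notation: the projection `π : M̂ → M ⧸ Λ` and the closure `K` of `η(Λ)` (`= Ker π`)
  set NΛ : FiniteIndexNormalSubgroup M := FiniteIndexNormalSubgroup.ofSubgroup Λ with hNΛ
  let π : profiniteCompletion M →* M ⧸ Λ :=
    MonoidHom.mk' (fun w => (w.val NΛ : M ⧸ Λ)) fun _ _ => rfl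
  have hπη : ∀ g : M, π (toCompletion M g) = QuotientGroup.mk g := fun g => rfl
  set K : Set (profiniteCompletion M) := closure (toCompletion M '' (Λ : Set M)) with hKdef
  have hKiff : ∀ w : profiniteCompletion M, w ∈ K ↔ π w = 1 :=
    fun w => mem_closure_image_iff_val_eq_one Λ w
  have hKmul : ∀ w₁ ∈ K, ∀ w₂ ∈ K, w₁ * w₂ ∈ K := fun w₁ h₁ w₂ h₂ => by
    rw [hKiff] at h₁ h₂ ⊢
    rw [map_mul, h₁, h₂, one_mul]
  have hKinv : ∀ w ∈ K, w⁻¹ ∈ K := fun w h => by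
    rw [hKiff] at h ⊢
    rw [map_inv, h, inv_one]
  have hKη : ∀ l ∈ Λ, toCompletion M l ∈ K := fun l hl => subset_closure ⟨l, hl, rfl⟩
  have hmemK : ∀ (g : M) (w : profiniteCompletion M),
      π w = QuotientGroup.mk g → (toCompletion M g)⁻¹ * w ∈ K := fun g w hw => by
    rw [hKiff, map_mul, map_inv, hπη, hw, inv_mul_cancel]
  -- `Z(η Λ) ∩ K = 1`
  have hKC : ∀ w : profiniteCompletion M, (∀ l ∈ Λ, w * toCompletion M l = toCompletion M l * w) →
      w ∈ K → w = 1 :=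
    fun w hw hwK => eq_one_of_mem_closure_of_forall_commute_of_center_trivial Λ hZ hwK hw
  -- Step 0: `y = η(m) · k₀` with `k₀ ∈ K`, i.e. `π y = m·Λ`
  obtain ⟨m, hk₀⟩ := exists_inv_mul_mem_closure Λ y
  have hyval : π y = QuotientGroup.mk m := by
    have h0 := (hKiff _).mp hk₀
    rw [map_mul, map_inv, hπη, inv_mul_eq_one] at h0
    exact h0.symm
  -- Case `m ∈ Λ`: then `y ∈ K`, hence `y = 1`
  by_cases hm : m ∈ Λ
  · refine hKC y hy ((hKiff y).mpr ?_)
    rw [hyval]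
    exact (QuotientGroup.eq_one_iff m).mpr hm
  exfalso
  -- Step 1: the order `o` of `m` modulo `Λ`; `y ^ o = 1`
  set o : ℕ := orderOf (QuotientGroup.mk m : M ⧸ Λ) with ho
  have hopos : 0 < o := orderOf_pos _
  haveI : NeZero o := ⟨hopos.ne'⟩
  have hypow : ∀ (t : ℕ), ∀ l ∈ Λ, y ^ t * toCompletion M l = toCompletion M l * y ^ t :=
    fun t l hl => ((show Commute y (toCompletion M l) from hy l hl).pow_left t).eq
  have hyo : y ^ o = 1 := by
    refine hKC _ (hypow o) ((hKiff _).mpr ?_)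
    rw [map_pow, hyval, ho, pow_orderOf_eq_one]
  -- Step 2: the element `x ∈ Λ` of (P) and the character `f : Λ → ℤ/o` with `f x = 1`
  obtain ⟨x, hxC, φ, hφx⟩ := hx
  let f : Λ →* Multiplicative (ZMod o) :=
    (AddMonoidHom.toMultiplicative (Int.castAddHom (ZMod o))).comp φ
  have hfx : f x = Multiplicative.ofAdd 1 := by
    change AddMonoidHom.toMultiplicative (Int.castAddHom (ZMod o)) (φ x) = _
    rw [hφx]
    change Multiplicative.ofAdd (((1 : ℤ) : ZMod o)) = _
    rw [Int.cast_one]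
  -- Step 3: the centraliser condition — `y = η(a) · k` with `a ∈ C_M(x)`, `a ≡ m (mod Λ)`, `k ∈ K`
  have hyx := hCC x x.2 y (hy x x.2)
  obtain ⟨a, haC, hax⟩ := val_mem_map_of_mem_closure hyx NΛ
  have hax' : (QuotientGroup.mk a : M ⧸ Λ) = QuotientGroup.mk m := by
    rw [← hyval]; exact hax
  have haxc : Commute a (x : M) := by
    rw [SetLike.mem_coe, Subgroup.mem_centralizer_iff] at haC
    exact (haC (x : M) (Set.mem_singleton _)).symm
  set k : profiniteCompletion M := (toCompletion M a)⁻¹ * y with hkdef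
  have hkK : k ∈ K := hmemK a y (by rw [hax', hyval])
  have hyk : y * k = k * y := commute_of_mem_closure hy hkK
  have hya : y = toCompletion M a * k := by rw [hkdef, mul_inv_cancel_left]
  have hak : Commute (toCompletion M a) k := by
    have e1 : toCompletion M a = y * k⁻¹ := by rw [hya, mul_inv_cancel_right]
    change toCompletion M a * k = k * toCompletion M a
    rw [e1, inv_mul_cancel_right, ← mul_assoc, ← hyk, mul_inv_cancel_right]
  -- Step 4: `k ^ o = η(a ^ o)⁻¹` and `a ^ o = x ^ j`
  have hko : k ^ o = (toCompletion M (a ^ o))⁻¹ := by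
    have e1 : (toCompletion M a) ^ o * k ^ o = 1 := by rw [← hak.mul_pow, ← hya, hyo]
    rw [map_pow]
    exact eq_inv_of_mul_eq_one_right e1
  have haoΛ : a ^ o ∈ Λ := by
    rw [← QuotientGroup.eq_one_iff, QuotientGroup.mk_pow, hax', ho, pow_orderOf_eq_one]
  have haoC : (⟨a ^ o, haoΛ⟩ : Λ) ∈ Subgroup.centralizer ({x} : Set Λ) := by
    rw [Subgroup.mem_centralizer_iff]
    intro w hw
    rw [Set.mem_singleton_iff] at hw
    subst hw
    exact Subtype.ext ((haxc.symm.pow_right o).eq)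
  rw [hxC, Subgroup.mem_zpowers_iff] at haoC
  obtain ⟨j, hj⟩ := haoC
  have hj' : (x : M) ^ j = a ^ o := by
    have := congrArg Subtype.val hj
    simpa using this
  -- Step 5: `o ∣ j`, by reading `k ^ o = η(x ^ (-j))` through `f̂ : Λ̂ → ℤ/o`
  have hkoj : k ^ o = toCompletion M ((x ^ (-j) : Λ) : M) := by
    rw [hko, ← map_inv, Subgroup.coe_zpow, zpow_neg, hj']
  obtain ⟨q, hq⟩ := exists_pow_eq_of_mem_closure_of_pow_eq Λ f hkK (x ^ (-j)).2 hkoj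
  have hqo : q ^ o = 1 := by
    have : Multiplicative.toAdd (q ^ o) = 0 := by
      rw [toAdd_pow, nsmul_eq_mul, ZMod.natCast_self, zero_mul]
    exact toAdd_eq_zero.mp this
  have hfxj : f (x ^ (-j)) = Multiplicative.ofAdd ((-j : ℤ) : ZMod o) := by
    rw [map_zpow, hfx, ← ofAdd_zsmul, zsmul_eq_mul, mul_one]
  have hdvd : (o : ℤ) ∣ j := by
    have e1 : ((-j : ℤ) : ZMod o) = 0 := by
      have e2 : Multiplicative.ofAdd ((-j : ℤ) : ZMod o) = 1 := by rw [← hfxj, ← hq, hqo]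
      exact ofAdd_eq_one.mp e2
    exact dvd_neg.mp ((ZMod.intCast_zmod_eq_zero_iff_dvd (-j) o).mp e1)
  obtain ⟨j', rfl⟩ := hdvd
  -- Step 6: the element `e := a * x ^ (-j')` has `e ^ o = 1` and `e ≡ m (mod Λ)`, so `e ∉ Λ`
  set e : M := a * (x : M) ^ (-j') with hedef
  have heo : e ^ o = 1 := by
    have h1 : a ^ o = (x : M) ^ ((o : ℤ) * j') := hj'.symm
    have h2 : ((x : M) ^ (-j')) ^ o = (x : M) ^ (-((o : ℤ) * j')) := by
      rw [← zpow_natCast, ← zpow_mul]; congr 1; ring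
    rw [hedef, (haxc.zpow_right (-j')).mul_pow, h1, h2, ← zpow_add, add_neg_cancel, zpow_zero]
  have hea : (QuotientGroup.mk e : M ⧸ Λ) = QuotientGroup.mk m := by
    rw [← hax', hedef, QuotientGroup.mk_mul,
      (QuotientGroup.eq_one_iff _).mpr (Λ.zpow_mem x.2 (-j')), mul_one]
  have henot : e ∉ Λ := fun he => hm (by
    rw [← QuotientGroup.eq_one_iff, ← hea, QuotientGroup.eq_one_iff]; exact he)
  -- Step 7: `y = η(e) · k'`; conjugation by `η(e)` agrees with conjugation by `k'⁻¹` on `K`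
  set k' : profiniteCompletion M := (toCompletion M e)⁻¹ * y with hk'def
  have hk'K : k' ∈ K := hmemK e y (by rw [hyval, hea])
  have hye : toCompletion M e = y * k'⁻¹ := by
    rw [hk'def, mul_inv_rev, inv_inv, mul_inv_cancel_left]
  have hconj : ∀ w ∈ K, toCompletion M e * w * (toCompletion M e)⁻¹ = k'⁻¹ * w * k'⁻¹⁻¹ := by
    intro w hw
    have hw' : k'⁻¹ * w * k' ∈ K := hKmul _ (hKmul _ (hKinv _ hk'K) _ hw) _ hk'K
    have e2 : y * (k'⁻¹ * w * k') = (k'⁻¹ * w * k') * y := commute_of_mem_closure hy hw'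
    rw [hye, inv_inv]
    calc y * k'⁻¹ * w * (y * k'⁻¹)⁻¹ = y * (k'⁻¹ * w * k') * y⁻¹ := by group
      _ = k'⁻¹ * w * k' := by rw [e2, mul_inv_cancel_right]
  -- iterate `o` times
  have hiter : ∀ t : ℕ, ∀ w ∈ K,
      (toCompletion M e) ^ t * w * ((toCompletion M e) ^ t)⁻¹ = (k'⁻¹) ^ t * w * ((k'⁻¹) ^ t)⁻¹ := by
    intro t
    induction t with
    | zero => intro w _; simp
    | succ t ih =>
      intro w hw
      have hw' : k'⁻¹ * w * k'⁻¹⁻¹ ∈ K :=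
        hKmul _ (hKmul _ (hKinv _ hk'K) _ hw) _ (hKinv _ (hKinv _ hk'K))
      calc (toCompletion M e) ^ (t + 1) * w * ((toCompletion M e) ^ (t + 1))⁻¹
          = (toCompletion M e) ^ t * (toCompletion M e * w * (toCompletion M e)⁻¹) *
              ((toCompletion M e) ^ t)⁻¹ := by rw [pow_succ']; group
        _ = (toCompletion M e) ^ t * (k'⁻¹ * w * k'⁻¹⁻¹) * ((toCompletion M e) ^ t)⁻¹ := by
              rw [hconj w hw]
        _ = (k'⁻¹) ^ t * (k'⁻¹ * w * k'⁻¹⁻¹) * ((k'⁻¹) ^ t)⁻¹ := ih _ hw'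
        _ = (k'⁻¹) ^ (t + 1) * w * ((k'⁻¹) ^ (t + 1))⁻¹ := by rw [pow_succ']; group
  -- `η(e) ^ o = 1`, so `(k'⁻¹) ^ o` commutes with `K`, hence is trivial, hence `k' = 1`
  have heo' : (toCompletion M e) ^ o = 1 := by rw [← map_pow, heo, map_one]
  have hc : (k'⁻¹) ^ o = 1 := by
    refine hKC _ (fun l hl => ?_) ?_
    · have := hiter o (toCompletion M l) (hKη l hl)
      rw [heo', one_mul, inv_one, mul_one] at this
      calc (k'⁻¹) ^ o * toCompletion M l
          = (k'⁻¹) ^ o * toCompletion M l * ((k'⁻¹) ^ o)⁻¹ * (k'⁻¹) ^ o := by group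
        _ = toCompletion M l * (k'⁻¹) ^ o := by rw [← this]
    · rw [hKiff, map_pow, (hKiff _).mp (hKinv _ hk'K), one_pow]
  have hk'1 : k' = 1 := by
    have := eq_one_of_mem_closure_of_pow_eq_one_of_torsionFree Λ hT (hKinv _ hk'K) hopos hc
    rwa [inv_eq_one] at this
  -- hence `η(e) = y` centralises `η(Λ)`, i.e. `e ∈ C_M(Λ) = 1`: contradiction with `e ∉ Λ`
  have hye' : toCompletion M e = y := by rw [hye, hk'1, inv_one, mul_one]
  have heC : e ∈ Subgroup.centralizer (Λ : Set M) := by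
    rw [Subgroup.mem_centralizer_iff]
    intro l hl
    have hcomm : e * l * e⁻¹ * l⁻¹ ∈ Λ := Λ.mul_mem (‹Λ.Normal›.conj_mem l hl e) (Λ.inv_mem hl)
    have h1 : toCompletion M (e * l * e⁻¹ * l⁻¹) = 1 := by
      rw [map_mul, map_mul, map_mul, map_inv, map_inv, hye', hy l hl]
      group
    have h2 := eq_one_of_toCompletion_eq_one_of_injective Λ hη hcomm h1
    calc l * e = (e * l * e⁻¹ * l⁻¹)⁻¹ * (e * l) := by group
      _ = e * l := by rw [h2, inv_one, one_mul]
  rw [hC, Subgroup.mem_bot] at heC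
  exact henot (heC ▸ Λ.one_mem)

/-- **`M̂` is slim** under the abstract hypotheses: if `Λ̂` is SLIM and every element of `M̂` commuting
with `η(Λ)` is trivial, then `M̂` is slim — the closure `H` of `η(Λ)` is a normal subgroup (the kernel
of `M̂ → M ⧸ Λ`), topologically isomorphic to `Λ̂` (comparison + compact-to-Hausdorff), hence slim, with
`C_{M̂}(H) = 1`; conclude by `IsSlimGroup.of_normal_of_centralizer_eq_bot`.
[cite: MochizukiAbsTopIII2015, Proposition 4.2 (i) proof p.106] -/
theorem isSlimGroup_completion_of_slim_of_centralizer_trivial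
    (hslim : IsSlimGroup (profiniteCompletion Λ))
    (hmain : ∀ y : profiniteCompletion M,
      (∀ l ∈ Λ, y * toCompletion M l = toCompletion M l * y) → y = 1) :
    IsSlimGroup (profiniteCompletion M) := by
  classical
  -- the closed subgroup `H = closure η(Λ)` of `M̂`
  let H : Subgroup (profiniteCompletion M) := (Λ.map (toCompletion M)).topologicalClosure
  have hHK : (H : Set (profiniteCompletion M)) = closure (toCompletion M '' (Λ : Set M)) := by
    rw [Subgroup.topologicalClosure_coe, Subgroup.coe_map]
  have hmemH : ∀ w, w ∈ H ↔ w ∈ closure (toCompletion M '' (Λ : Set M)) := fun w => by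
    rw [← SetLike.mem_coe, hHK]
  -- `H` is normal: it is the kernel of `M̂ → M ⧸ Λ`
  haveI : H.Normal := ⟨fun w hw g => by
    rw [hmemH, mem_closure_image_iff_val_eq_one] at hw ⊢
    let π : profiniteCompletion M →* M ⧸ Λ :=
      MonoidHom.mk' (fun w => (w.val (FiniteIndexNormalSubgroup.ofSubgroup Λ) : M ⧸ Λ)) fun _ _ => rfl
    change π (g * w * g⁻¹) = 1
    change π w = 1 at hw
    rw [map_mul, map_mul, map_inv, hw, mul_one, mul_inv_cancel]⟩
  -- `H ≅ Λ̂` is slim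
  obtain ⟨ι, hιc, hιi, hιη, hιr⟩ := exists_comparison Λ
  have hrange : ∀ z, ι z ∈ H := fun z => by
    rw [hmemH, ← hιr]; exact ⟨z, rfl⟩
  let f : profiniteCompletion Λ →* H := ι.codRestrict H hrange
  have hf_bij : Function.Bijective f := by
    refine ⟨fun z₁ z₂ h => hιi (congrArg Subtype.val h), fun w => ?_⟩
    have hw : (w : profiniteCompletion M) ∈ Set.range ι := by rw [hιr, ← hmemH]; exact w.2
    obtain ⟨z, hz⟩ := hw
    exact ⟨z, Subtype.ext hz⟩
  have hf_cont : Continuous f := hιc.subtype_mk _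
  let e₀ : profiniteCompletion Λ ≃* H := MulEquiv.ofBijective f hf_bij
  let eₜ : profiniteCompletion Λ ≃ₜ H :=
    Continuous.homeoOfEquivCompactToT2 (f := Equiv.ofBijective f hf_bij) hf_cont
  let e : profiniteCompletion Λ ≃ₜ* H :=
    { e₀ with
      continuous_toFun := hf_cont
      continuous_invFun := eₜ.continuous_symm }
  have hHslim : IsSlimGroup H :=
    Literature.AnabelianGeometry.AbsoluteAnabelian.IsSlimGroup.of_continuousMulEquiv_left e hslim
  -- `C_{M̂}(H) = 1` by `hmain`
  have hCH : Subgroup.centralizer (H : Set (profiniteCompletion M)) = ⊥ := by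
    rw [eq_bot_iff]
    intro w hw
    rw [Subgroup.mem_centralizer_iff] at hw
    rw [Subgroup.mem_bot]
    refine hmain w fun l hl => (hw _ ?_).symm
    rw [SetLike.mem_coe, hmemH]
    exact subset_closure ⟨l, hl, rfl⟩
  exact IsSlimGroup.of_normal_of_centralizer_eq_bot H hHslim hCH

end Abstract

end Literature.GroupTheory

end
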